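import Literature.AlgebraicGeometry.HodgeTheory.WeilTypeRationalDatumDiscriminant
import Literature.AlgebraicGeometry.HodgeTheory.AnticommutingEndomorphismMixedClassTopPower
import Literature.AlgebraicGeometry.HodgeTheory.WeilTypeOfQuaternionAction
import Literature.AlgebraicGeometry.Motives.RationalDegreeOneModelWeilType
import Literature.AlgebraicGeometry.Motives.WeilOperatorModule
import Literature.AlgebraicGeometry.Motives.WeilDatumWeilPolarization
import Literature.AlgebraicGeometry.Motives.WeilDiscriminantTypeII
import HarnessLib

/-!
# `det H = (-b)ⁿ` for an abelian `2n`-fold of Weil type carrying an indefinite quaternion algebra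
# `D = K ⊕ Kψ`, `ψ² = b`, `ψ` Rosati-symmetric (Albert type II), ON THE CARRIERS

Family `hodge`, layer `Literature/AlgebraicGeometry/VanGeemen1994`; THEOREMS ONLY (no definition, no named
fact, no `sorry`; D-0026). Companion of `VanGeemen1994/WeilDiscriminantClass` (van Geemen's isogeny
invariant `det H ∈ ℚˣ ⧸ Nm(K_dˣ)` ON THE CARRIERS, `HasWeilDiscriminantNondeg A φ n d h δ`, LNM 1594 Lemma 5.2
(2)–(3), 4.14), of `VanGeemen1994/WeilDiscriminantOfHyperbolic` (split members: `δ = [(-1)ⁿ]`) and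
`VanGeemen1994/WeilDiscriminantOfCMType`, and the carrier-level form of the `K`-module lemma
`Motives/WeilDiscriminantTypeII.weilDiscriminant_eq_of_typeII` (a Weil form with a Rosati-symmetric
`K`-antilinear `j`, `j² = b`, has `det H = (-b)ⁿ`).

SETTING (van Geemen–Verra 2003, proof of Lemma 4.5: "there is a `j ∈ F` such that `F = K ⊕ Kj` and
`xj = j x̄` for `x ∈ K`"; Mumford §21 / Birkenhake–Lange §5.5: the Rosati involution is positive, so a
Rosati-symmetric `j` has `j² > 0` and `D` is indefinite, Albert type II). In the tree's carrier vocabulary: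
`A` a complex abelian variety of dimension `m + 1 = 2n`, `φ ≫ φ = -d` (`K = ℚ(φ)`, `d ≥ 1`), an endomorphism
`ψ` with `φ ≫ ψ = -(ψ ≫ φ)` and `ψ ≫ ψ = b • 𝟙` (`b ≥ 1`), and the `K`-symmetrised hyperplane class
`h_K = d·e^*a + φ^*e^*a` with **`ψ^* h_K = b · h_K`** (`ψ` is `h_K`-symmetric: the Rosati involution of `h_K`
fixes `ψ`).

## What is proved (0 sorry)

* `det_eq_neg_pow_of_anticomm` — linear algebra: `T² = b = β²`, `S T = -T S` with `S` injective,
  `dim V = 2k`, `bτ² = -1` ⟹ `det T = (-b)ᵏ` (from `det(1 + tT) = (1 - bt²)ᵏ`,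
  `HodgeTheory/AnticommutingEndomorphismMixedClassTopPower`, applied at `t = τ` and `t = (τb)⁻¹`).
* `polarizationPairingOne_map_map_of_anticomm` — **`Q_{h}(ψ^*x, ψ^*y) = b · Q_{h}(x, y)`** on
  `H¹(A(ℂ); ℂ)` for `dim A = 2n`, `ψ^* h = b·h`: naturality `ψ^* Q_h = Q_{ψ^*h}(ψ^*·, ψ^*·)`, `Q_{bh} = b^m Q_h`,
  and `ψ^* = det(ψ^*|_{H¹}) = (-b)^{2n} = b^{2n}` on the top cohomology (`Motives.map_top_eq_det_smul`).
* `bettiMap_anticomm`, `bettiMap_bettiMap_of_comp_eq_nsmul`, `weilDatumOfKsymm_E_map_map_of_anticomm` —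
  the same on the rational lattice `H¹(A(ℂ); ℚ)` and for the rational Riemann form `E` of the datum
  `weilDatumOfKsymm`: `ψ^*_ℚ φ^*_ℚ = -φ^*_ℚ ψ^*_ℚ`, `(ψ^*_ℚ)² = b`, `E(ψ^*x, ψ^*y) = b E(x, y)`, hence
  `E(ψ^*x, y) = E(x, ψ^*y)` (`weilDatumOfKsymm_E_map_left_of_anticomm`).
* **`HasWeilDiscriminantNondeg.eq_mk_neg_pow_of_anticomm`** — THE PRICING ON THE CARRIERS: every
  non-degenerate discriminant witness of `(A, φ, n, d, h_K)` has class **`δ = [(-b)ⁿ]`**; for `n` odd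
  `δ = [-b]` (`…_of_odd`), for `n` even `δ = 1` (`…_of_even`). So a member of the Weil component
  `(n, K_d, δ)` can carry such a `ψ` only if `δ = [(-b)ⁿ]`: on SIXFOLD components (`n = 3`) the quaternion
  algebra met is `D_δ = (-d, -δ₀)_ℚ`, and for even `n` type-II members with `K ⊂ D` lie on the split
  component only.

## References

* [vanGeemen1994HodgeAV] B. van Geemen, LNM 1594 (1994), Lemma 5.2 (2)–(3), 4.14, 5.4.
* [vanGeemenVerra2003QuaternionicPryms] B. van Geemen, A. Verra, Topology 42 (2003), Lemma 4.5 (proof).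
* [Lange2023AbelianVarietiesComplex] H. Lange, Abelian Varieties over the Complex Numbers (Grundlehren Text Editions,
  2023), Prop. 1.1.9 (the extended rational representation `≅ ρ_a ⊕ ρ̄_a`), Lemma 1.1.17 (`H¹(X,ℤ) = Hom(Λ,ℤ)`,
  `⋀²H¹ ≅ H²`), Exercise 1.1.6 (8). (The literature store holds this text under the key
  `book:lange1992-complex-abelian-varieties`; its three-level numbers are Lange 2023 numbers.)
* [LangeBirkenhake1992] H. Lange, Ch. Birkenhake, Complex Abelian Varieties (1992), §5.1 (Rosati involution).
* [MumfordAV1970] D. Mumford, Abelian Varieties (1970), §21.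
-/

noncomputable section

open CategoryTheory Polynomial Module
open Literature.AlgebraicTopology.SingularHomology
open Literature.AlgebraicGeometry.Motives
open Literature.AlgebraicGeometry.HodgeTheory

namespace Literature.AlgebraicGeometry.VanGeemen1994

/-! ### Linear algebra: `det T = (-b)ᵏ` for `T² = b` anticommuting with an injective `S` -/

section Det

variable {K V : Type*} [Field K] [NeZero (2 : K)] [AddCommGroup V] [Module K V] [FiniteDimensional K V]

/-- **`det T = (-b)ᵏ`** for `T² = b = β²` (`β ≠ 0`), `S T = -T S` with `S` injective, `dim V = 2k`, granted a
`τ` with `bτ² = -1`: from `det(1 + tT) = (1 - bt²)ᵏ` (eigenspace balance, van Geemen–Verra's "the eigenspaces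
… are permuted by the action of `j` and therefore they have the same dimension") at `t = τ` and at
`t = (τb)⁻¹`, using `T(1 + τT) = T + τb = τb·(1 + (τb)⁻¹T)`. [cite: vanGeemenVerra2003QuaternionicPryms, Lemma 4.5 (proof)]
[cite: Lange2023AbelianVarietiesComplex, Exercise 1.1.6 (8)] -/
theorem det_eq_neg_pow_of_anticomm (T S : V →ₗ[K] V) {b β τ : K} (hβ : β * β = b) (hβ0 : β ≠ 0)
    (hT : T ∘ₗ T = b • LinearMap.id) (hS : S ∘ₗ T = -(T ∘ₗ S)) (hSi : Function.Injective S) {k : ℕ}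
    (hV : Module.finrank K V = 2 * k) (hτ : b * τ ^ 2 = -1) : LinearMap.det T = (-b) ^ k := by
  have hb0 : b ≠ 0 := by rw [← hβ]; exact mul_ne_zero hβ0 hβ0
  have hτ0 : τ ≠ 0 := by
    rintro rfl
    rw [zero_pow two_ne_zero, mul_zero] at hτ
    exact absurd hτ.symm (neg_ne_zero.2 one_ne_zero)
  have hτb : τ * b ≠ 0 := mul_ne_zero hτ0 hb0
  have hTT : ∀ v, T (T v) = b • v := fun v => by
    simpa only [LinearMap.comp_apply, LinearMap.smul_apply, LinearMap.id_apply] using LinearMap.congr_fun hT v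
  -- `det(1 + tT) = (1 - bt²)ᵏ`
  have hdet := fun t => HodgeTheory.LinearMap.det_id_add_smul_of_anticomm T S hβ hβ0 hT hS hSi hV t
  have h1 : LinearMap.det (LinearMap.id + τ • T) = 2 ^ k := by
    rw [hdet, show (1 : K) - b * τ ^ 2 = 2 by rw [hτ]; norm_num]
  have h2 : LinearMap.det (LinearMap.id + (τ * b)⁻¹ • T) = 2 ^ k := by
    rw [hdet]
    congr 1
    field_simp
    linear_combination (-1 : K) * hτ
  -- `T ∘ (1 + τT) = τb · (1 + (τb)⁻¹ T)`
  have hcomp : T ∘ₗ (LinearMap.id + τ • T) = (τ * b) • (LinearMap.id + (τ * b)⁻¹ • T) := by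
    ext v
    simp only [LinearMap.comp_apply, LinearMap.add_apply, LinearMap.id_apply, LinearMap.smul_apply, map_add,
      map_smul, hTT, smul_add, smul_smul, mul_inv_cancel₀ hτb, one_smul]
    rw [add_comm, mul_comm τ b]
  have hd := congrArg LinearMap.det hcomp
  rw [LinearMap.det_comp, h1, LinearMap.det_smul, h2, hV] at hd
  have h2k : (2 : K) ^ k ≠ 0 := pow_ne_zero _ (NeZero.ne 2)
  have hpow : (τ * b) ^ (2 * k) = (-b) ^ k := by
    rw [pow_mul, show (τ * b) ^ 2 = -b by linear_combination b * hτ]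
  rw [hpow] at hd
  exact mul_right_cancel₀ h2k hd

end Det

/-! ### `Q_h(ψ^*x, ψ^*y) = b · Q_h(x, y)` for `ψ² = b` anticommuting with `φ`, `ψ^*h = b·h` -/

section Similitude

variable {m d b : ℕ} {A : AbelianVariety ℂ} {φ ψ : A ⟶ A}

/-- **`det(ψ^*|_{H¹}) = (-b)^{dim A}`** for `ψ ≫ ψ = b • 𝟙` (`b ≥ 1`) anticommuting with `φ`, `φ ≫ φ = -d`
(`d ≥ 1`): the `±√b`-eigenspaces of `ψ^*` on `H¹(A(ℂ); ℂ)` are exchanged by the injective `φ^*`.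
[cite: vanGeemenVerra2003QuaternionicPryms, Lemma 4.5 (proof)] [cite: Lange2023AbelianVarietiesComplex, Prop. 1.1.9 and Lemma 1.1.17] -/
theorem det_map_one_eq_neg_pow_of_anticomm (hd : 0 < d) (hφ : φ ≫ φ = -(d • 𝟙 A))
    (hφψ : φ ≫ ψ = -(ψ ≫ φ)) (hψ : ψ ≫ ψ = b • 𝟙 A) (hb : b ≠ 0) :
    LinearMap.det (complexBetti.map ψ.hom.hom.hom 1).hom = (-(b : ℂ)) ^ A.dim := by
  haveI := finite_complexBetti_abelianVariety A 1
  set ψ₁ : complexBetti A.X 1 →ₗ[ℂ] complexBetti A.X 1 := (complexBetti.map ψ.hom.hom.hom 1).hom with hψ₁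
  set φ₁ : complexBetti A.X 1 →ₗ[ℂ] complexBetti A.X 1 := (complexBetti.map φ.hom.hom.hom 1).hom with hφ₁
  have hT : ψ₁ ∘ₗ ψ₁ = (b : ℂ) • LinearMap.id := by
    ext v
    change complexBetti.map ψ.hom.hom.hom 1 (complexBetti.map ψ.hom.hom.hom 1 v) = (b : ℂ) • v
    rw [complexBetti_map_map_hom, hψ, complexBetti_map_nsmul_id_one_apply]
  have hS : φ₁ ∘ₗ ψ₁ = -(ψ₁ ∘ₗ φ₁) := by
    ext v
    change complexBetti.map φ.hom.hom.hom 1 (complexBetti.map ψ.hom.hom.hom 1 v) =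
      -(complexBetti.map ψ.hom.hom.hom 1 (complexBetti.map φ.hom.hom.hom 1 v))
    rw [complexBetti_map_map_hom, complexBetti_map_map_hom, hφψ, complexBetti_map_neg_deg_one]
  have hSi : Function.Injective φ₁ := by
    intro v w hvw
    have hφφ : ∀ u, φ₁ (φ₁ u) = -((d : ℂ) • u) := fun u => by
      change complexBetti.map φ.hom.hom.hom 1 (complexBetti.map φ.hom.hom.hom 1 u) = -((d : ℂ) • u)
      rw [complexBetti_map_map_hom, hφ, complexBetti_map_neg_deg_one, complexBetti_map_nsmul_id_one_apply]
    have e := congrArg φ₁ hvw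
    rw [hφφ, hφφ, neg_inj] at e
    exact smul_right_injective _ (Nat.cast_ne_zero.2 hd.ne') e
  have hb' : (b : ℂ) ≠ 0 := Nat.cast_ne_zero.2 hb
  obtain ⟨β, hβ⟩ := IsAlgClosed.exists_pow_nat_eq (b : ℂ) two_pos
  have hββ : β * β = b := by rw [← hβ, pow_two]
  have hβ0 : β ≠ 0 := by rintro rfl; rw [zero_pow two_ne_zero] at hβ; exact hb' hβ.symm
  obtain ⟨τ, hτ⟩ := IsAlgClosed.exists_pow_nat_eq (-((b : ℂ)⁻¹)) two_pos
  have hbτ : (b : ℂ) * τ ^ 2 = -1 := by rw [hτ, mul_neg, mul_inv_cancel₀ hb']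
  have hV : Module.finrank ℂ (complexBetti A.X 1) = 2 * A.dim := AbelianVariety.finrank_complexBetti_one A
  exact det_eq_neg_pow_of_anticomm ψ₁ φ₁ hββ hβ0 hT hS hSi hV hbτ

/-- **`Q_h(ψ^*x, ψ^*y) = b · Q_h(x, y)` on `H¹(A(ℂ); ℂ)`** for `dim A = m + 1` EVEN, `ψ ≫ ψ = b • 𝟙` (`b ≥ 1`)
anticommuting with `φ` (`φ ≫ φ = -d`, `d ≥ 1`) and a class `h` with `ψ^*h = b·h` (`ψ` is `h`-symmetric):
naturality `ψ^* Q_h(x, y) = Q_{ψ^*h}(ψ^*x, ψ^*y)` (`Motives.map_polarizationPairingOne`), `Q_{b h} = b^m Q_h`,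
and `ψ^*` acts on the top cohomology by `det(ψ^*|_{H¹}) = (-b)^{m+1} = b^{m+1}`
(`Motives.map_top_eq_det_smul`; `H• = ⋀•H¹`). The multiplier is `+b`: `ψ^*` is a similitude of the
polarization form with POSITIVE multiplier — the form-level meaning of Rosati-symmetry of `ψ`.
[cite: Lange2023AbelianVarietiesComplex, Lemma 1.1.17] [cite: LangeBirkenhake1992, §5.1] [cite: vanGeemen1994HodgeAV, 4.9 and Lemma 5.2 (2)] -/
theorem polarizationPairingOne_map_map_of_anticomm (hA : A.dim = m + 1) (hev : Even (m + 1)) (hd : 0 < d)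
    (hφ : φ ≫ φ = -(d • 𝟙 A)) (hφψ : φ ≫ ψ = -(ψ ≫ φ)) (hψ : ψ ≫ ψ = b • 𝟙 A) (hb : b ≠ 0)
    {h : complexBetti A.X 2} (hψh : complexBetti.map ψ.hom.hom.hom 2 h = (b : ℂ) • h)
    (x y : complexBetti A.X 1) :
    polarizationPairingOne A.X h m (complexBetti.map ψ.hom.hom.hom 1 x) (complexBetti.map ψ.hom.hom.hom 1 y) =
      (b : ℂ) • polarizationPairingOne A.X h m x y := by
  have hrank := Motives.abelianVarietyCohomologyExteriorH1.finrank_one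
    Motives.abelianVarietyCohomologyExteriorH1_holds A
  have hspan := Motives.abelianVarietyCohomologyExteriorH1.span_range_cupPowOne
    Motives.abelianVarietyCohomologyExteriorH1_holds A (2 + 2 * m)
  have e2 := Motives.map_polarizationPairingOne ψ.hom.hom.hom h m x y
  rw [hψh, Motives.polarizationPairingOne_smul, Motives.map_top_eq_det_smul hA hrank hspan ψ,
    det_map_one_eq_neg_pow_of_anticomm hd hφ hφψ hψ hb, hA, Even.neg_pow hev, pow_succ, mul_smul] at e2
  have hb0 : ((b : ℂ) ^ m) ≠ 0 := pow_ne_zero _ (Nat.cast_ne_zero.2 hb)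
  exact (smul_right_injective _ hb0 e2).symm

end Similitude

/-! ### On the rational lattice `H¹(A(ℂ); ℚ)` and the rational Riemann form of `h_K` -/

section Rational

variable {m d b : ℕ} {A : AbelianVariety ℂ} {φ ψ : A ⟶ A}

/-- `ψ^*_ℚ φ^*_ℚ = -φ^*_ℚ ψ^*_ℚ` on `H¹(A(ℂ); ℚ)` for anticommuting `φ`, `ψ` (descended along the injective
`H¹(ℚ) → H¹(ℂ)` from `complexBetti_map_map_one_of_anticomm`). [cite: vanGeemenVerra2003QuaternionicPryms, Lemma 4.5 (proof)] -/
theorem bettiMap_anticomm (hφψ : φ ≫ ψ = -(ψ ≫ φ)) (x : bettiCohomology A.X 1) :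
    bettiCohomology.map ψ.hom.hom.hom 1 (bettiCohomology.map φ.hom.hom.hom 1 x) =
      -(bettiCohomology.map φ.hom.hom.hom 1 (bettiCohomology.map ψ.hom.hom.hom 1 x)) := by
  apply ofRatClass_injective (Y := ComplexPoints A.X) 1
  rw [ofRatClass_bettiMap, ofRatClass_bettiMap, map_neg, ofRatClass_bettiMap, ofRatClass_bettiMap,
    complexBetti_map_map_one_of_anticomm hφψ, neg_neg]

/-- `(ψ^*_ℚ)² = b` on `H¹(A(ℂ); ℚ)` for `ψ ≫ ψ = b • 𝟙` (`[b]^* = b` on `H¹`, Mumford §1 (3)).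
[cite: MumfordAV1970, §1 (3) and §19] -/
theorem bettiMap_bettiMap_of_comp_eq_nsmul (hψ : ψ ≫ ψ = b • 𝟙 A) (x : bettiCohomology A.X 1) :
    bettiCohomology.map ψ.hom.hom.hom 1 (bettiCohomology.map ψ.hom.hom.hom 1 x) = (b : ℚ) • x := by
  apply ofRatClass_injective (Y := ComplexPoints A.X) 1
  rw [ofRatClass_bettiMap, ofRatClass_bettiMap, Motives.ofRatClass_smul, Rat.cast_natCast,
    complexBetti_map_map_hom, hψ, complexBetti_map_nsmul_id_one_apply]

/-- **`E(ψ^*x, ψ^*y) = b · E(x, y)`** for the rational Riemann form `E` of the datum of `(A, φ, h_K)`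
(`weilDatumOfKsymm`; `dim A = m + 1` even, `ψ ≫ ψ = b • 𝟙` anticommuting with `φ`, `ψ^* h_K = b·h_K`): the
rational reading of `polarizationPairingOne_map_map_of_anticomm`. [cite: vanGeemen1994HodgeAV, 4.9 and Lemma 5.2 (2)]
[cite: Lange2023AbelianVarietiesComplex, Lemma 1.1.17] [cite: LangeBirkenhake1992, §5.1] -/
theorem weilDatumOfKsymm_E_map_map_of_anticomm (hm : 1 ≤ m) (hA : A.dim = m + 1) (hev : Even (m + 1))
    (hd : 0 < d) (hφ : φ ≫ φ = -(d • 𝟙 A)) (hφψ : φ ≫ ψ = -(ψ ≫ φ)) (hψ : ψ ≫ ψ = b • 𝟙 A) (hb : b ≠ 0)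
    (e : ProjectiveEmbedding A.X) {a : complexBetti (projectiveSpace e.n ℂ) 2} (ha : IsRationalClass a)
    (ha0 : a ≠ 0) {ω₀ : complexBetti A.X (2 + 2 * m)} (hω : IsRationalClass ω₀) (hω0 : ω₀ ≠ 0)
    (hψh : complexBetti.map ψ.hom.hom.hom 2
        ((d : ℂ) • complexBetti.map e.ι 2 a + complexBetti.map φ.hom.hom.hom 2 (complexBetti.map e.ι 2 a)) =
      (b : ℂ) • ((d : ℂ) • complexBetti.map e.ι 2 a + complexBetti.map φ.hom.hom.hom 2 (complexBetti.map e.ι 2 a)))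
    (x y : bettiCohomology A.X 1) :
    (weilDatumOfKsymm hm hA hd hφ e ha ha0 hω hω0).E (bettiCohomology.map ψ.hom.hom.hom 1 x)
        (bettiCohomology.map ψ.hom.hom.hom 1 y) =
      (b : ℚ) * (weilDatumOfKsymm hm hA hd hφ e ha ha0 hω hω0).E x y := by
  apply Rat.cast_injective (α := ℂ)
  rw [weilDatumOfKsymm_E, Rat.cast_mul, Rat.cast_natCast, ratPolarizationForm_spec, ratPolarizationForm_spec,
    ofRatClass_bettiMap, ofRatClass_bettiMap, polarizationPairingOne_map_map_of_anticomm hA hev hd hφ hφψ hψ hb hψh,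
    map_smul, smul_eq_mul]

/-- **Rosati-symmetry of `ψ` for the rational Riemann form: `E(ψ^*x, y) = E(x, ψ^*y)`** (from
`E(ψ^*x, ψ^*y) = b E(x, y)` and `(ψ^*)² = b`: write `y = ψ^*(b⁻¹ ψ^* y)`). [cite: Lange2023AbelianVarietiesComplex, Lemma 1.1.17] [cite: LangeBirkenhake1992, §5.1] -/
theorem weilDatumOfKsymm_E_map_left_of_anticomm (hm : 1 ≤ m) (hA : A.dim = m + 1) (hev : Even (m + 1))
    (hd : 0 < d) (hφ : φ ≫ φ = -(d • 𝟙 A)) (hφψ : φ ≫ ψ = -(ψ ≫ φ)) (hψ : ψ ≫ ψ = b • 𝟙 A) (hb : b ≠ 0)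
    (e : ProjectiveEmbedding A.X) {a : complexBetti (projectiveSpace e.n ℂ) 2} (ha : IsRationalClass a)
    (ha0 : a ≠ 0) {ω₀ : complexBetti A.X (2 + 2 * m)} (hω : IsRationalClass ω₀) (hω0 : ω₀ ≠ 0)
    (hψh : complexBetti.map ψ.hom.hom.hom 2
        ((d : ℂ) • complexBetti.map e.ι 2 a + complexBetti.map φ.hom.hom.hom 2 (complexBetti.map e.ι 2 a)) =
      (b : ℂ) • ((d : ℂ) • complexBetti.map e.ι 2 a + complexBetti.map φ.hom.hom.hom 2 (complexBetti.map e.ι 2 a)))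
    (x y : bettiCohomology A.X 1) :
    (weilDatumOfKsymm hm hA hd hφ e ha ha0 hω hω0).E (bettiCohomology.map ψ.hom.hom.hom 1 x) y =
      (weilDatumOfKsymm hm hA hd hφ e ha ha0 hω hω0).E x (bettiCohomology.map ψ.hom.hom.hom 1 y) := by
  set D := weilDatumOfKsymm hm hA hd hφ e ha ha0 hω hω0 with hD
  have hb' : (b : ℚ) ≠ 0 := Nat.cast_ne_zero.2 hb
  have hy : y = bettiCohomology.map ψ.hom.hom.hom 1 ((b : ℚ)⁻¹ • bettiCohomology.map ψ.hom.hom.hom 1 y) := by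
    rw [map_smul, bettiMap_bettiMap_of_comp_eq_nsmul hψ, smul_smul, inv_mul_cancel₀ hb', one_smul]
  conv_lhs => rw [hy]
  rw [hD, weilDatumOfKsymm_E_map_map_of_anticomm hm hA hev hd hφ hφψ hψ hb e ha ha0 hω hω0 hψh, map_smul,
    smul_eq_mul, ← mul_assoc, mul_inv_cancel₀ hb', one_mul]

end Rational

/-! ### The pricing on the carriers: `det H = (-b)ⁿ` for members carrying `ψ` -/

section Carriers

variable {m n d b : ℕ} {A : AbelianVariety ℂ} {φ ψ : A ⟶ A}

/-- **`det H = (-b)ⁿ` ON THE CARRIERS.** Let `A` be a complex abelian variety of dimension `m + 1 = 2n ≥ 2`,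
`φ ≫ φ = -d` (`d ≥ 1`, `K = ℚ(φ) ≅ ℚ(√-d)`), and `ψ` an endomorphism with `φ ≫ ψ = -(ψ ≫ φ)`, `ψ ≫ ψ = b • 𝟙`
(`b ≥ 1`; `D = K ⊕ Kψ = (-d, b)_ℚ`, the setting of van Geemen–Verra's Lemma 4.5: "`F = K ⊕ Kj`, `xj = j x̄`"),
which is symmetric for the `K`-symmetrised hyperplane class `h_K = d·e^*a + φ^*e^*a` (`ψ^* h_K = b·h_K`). Then
EVERY non-degenerate witness of van Geemen's invariant `det H ∈ ℚˣ ⧸ Nm(K_dˣ)` of `(A, φ, h_K)`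
(`HasWeilDiscriminantNondeg A φ n d h_K δ`, Lemma 5.2 (2)–(3), 4.14) has class **`δ = (-b)ⁿ · Nm(K_dˣ)`**.
Proof: on the rational datum `(H¹(A; ℚ), φ^*_ℚ, E)` (`weilDatumOfKsymm`) with its `K_d`-structure
(`√-d ↦ φ^*_ℚ`, `Motives.exists_module_smul_eq`) the operator `ψ^*_ℚ` is `K_d`-antilinear, `(ψ^*_ℚ)² = b`, and
Rosati-symmetric for `E` (`weilDatumOfKsymm_E_map_left_of_anticomm`); the `K`-module lemma
`Motives.weilDiscriminant_eq_mk_of_typeII` gives `det H_E = [(-b)ⁿ]`, and `det H_E` is the class of every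
witness (`quotientMk_eq_weilDiscriminant_weilDatumOfKsymm`, van Geemen 5.2 (3)).
[cite: vanGeemen1994HodgeAV, Lemma 5.2 (2)–(3) and 4.14] [cite: vanGeemenVerra2003QuaternionicPryms, Lemma 4.5 (proof)] -/
theorem HasWeilDiscriminantNondeg.eq_mk_neg_pow_of_anticomm (hn : 1 ≤ n) (hmn : m + 1 = 2 * n) (hd : 0 < d)
    (hA : A.dim = m + 1) (hφ : φ ≫ φ = -(d • 𝟙 A)) (hφψ : φ ≫ ψ = -(ψ ≫ φ)) (hψ : ψ ≫ ψ = b • 𝟙 A)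
    (hb : b ≠ 0) (e : ProjectiveEmbedding A.X) {a : complexBetti (projectiveSpace e.n ℂ) 2}
    (ha : IsRationalClass a) (ha0 : a ≠ 0)
    (hψh : complexBetti.map ψ.hom.hom.hom 2
        ((d : ℂ) • complexBetti.map e.ι 2 a + complexBetti.map φ.hom.hom.hom 2 (complexBetti.map e.ι 2 a)) =
      (b : ℂ) • ((d : ℂ) • complexBetti.map e.ι 2 a + complexBetti.map φ.hom.hom.hom 2 (complexBetti.map e.ι 2 a)))
    {δ : weilNormResidueGroup d}
    (hδ : HasWeilDiscriminantNondeg A φ n d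
      ((d : ℂ) • complexBetti.map e.ι 2 a + complexBetti.map φ.hom.hom.hom 2 (complexBetti.map e.ι 2 a)) δ) :
    δ = (QuotientGroup.mk (Units.mk0 ((-(b : ℚ)) ^ n)
      (pow_ne_zero n (neg_ne_zero.2 (Nat.cast_ne_zero.2 hb)))) : weilNormResidueGroup d) := by
  classical
  have hX : IsSmoothProjective (m + 1) A.X := Motives.isSmoothProjective_of_dim_eq' hA
  have hev : Even (m + 1) := ⟨n, by omega⟩
  -- a rational generator of the top line, and the datum
  obtain ⟨ω₀, hω, hω0⟩ := Motives.exists_isRationalClass_ne_zero_two_add_two_mul hX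
  set DA := weilDatumOfKsymm (by omega) hA hd hφ e ha ha0 hω hω0 with hDA
  haveI : Module.Finite ℚ ↥(bettiCohomology A.X 1) := finite_bettiCohomology_one A
  have hVA : Module.finrank ℚ ↥(bettiCohomology A.X 1) = 4 * n := by
    rw [finrank_bettiCohomology_one, hA]; omega
  -- the field `K_d = ℚ(√-d)`, `α = √-d`, its conjugation `σ`
  haveI : Fact (Irreducible (X ^ 2 + C (d : ℚ) : ℚ[X])) := ⟨irreducible_X_sq_add_C hd⟩
  have hdQ : (0 : ℚ) < d := by exact_mod_cast hd
  have hα : weilSqrt d * weilSqrt d = algebraMap ℚ (weilField d) (-(d : ℚ)) :=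
    weilSqrt_mul_self_eq_algebraMap d
  have hKspan : ∀ k : weilField d, ∃ p q : ℚ,
      k = algebraMap ℚ (weilField d) p + algebraMap ℚ (weilField d) q * weilSqrt d :=
    exists_eq_algebraMap_add_mul_weilSqrt d
  have hK2 : Module.finrank ℚ (weilField d) = 2 := Motives.finrank_rat_eq_two_of_sq_eq_neg hdQ hα hKspan
  obtain ⟨σ, hσα⟩ := exists_ringHom_weilSqrt_eq_neg d
  have hσ : ∀ k : weilField d, k * σ k = algebraMap ℚ (weilField d) (Algebra.norm ℚ k) :=
    mul_conj_eq_algebraMap_norm hdQ hα hKspan σ hσα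
  -- the `K_d`-structure `√-d ↦ φ^*_ℚ`
  obtain ⟨instA, hinstA⟩ := exists_module_smul_eq hdQ hα hKspan DA.α DA.α_α
  letI : Module (weilField d) ↥(bettiCohomology A.X 1) := instA
  haveI : IsScalarTower ℚ (weilField d) ↥(bettiCohomology A.X 1) := hinstA.1
  have hαA : ∀ v, weilSqrt d • v = DA.α v := hinstA.2
  haveI : Module.Finite (weilField d) ↥(bettiCohomology A.X 1) :=
    Module.Finite.of_restrictScalars_finite ℚ (weilField d) _
  have hVK : Module.finrank (weilField d) ↥(bettiCohomology A.X 1) = 2 * n := by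
    have h := Module.finrank_mul_finrank ℚ (weilField d) ↥(bettiCohomology A.X 1)
    rw [hK2, hVA] at h
    omega
  have hWA : ∀ x y : ↥(bettiCohomology A.X 1), DA.E (weilSqrt d • x) (weilSqrt d • y) = (d : ℚ) * DA.E x y :=
    fun x y => by rw [hαA, hαA]; exact DA.E_α x y
  -- the type-II operator `j = ψ^*_ℚ`
  set j : ↥(bettiCohomology A.X 1) →ₗ[ℚ] ↥(bettiCohomology A.X 1) := (bettiCohomology.map ψ.hom.hom.hom 1).hom
    with hj
  have hjap : ∀ x, j x = bettiCohomology.map ψ.hom.hom.hom 1 x := fun x => rfl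
  have hbQ : (b : ℚ) ≠ 0 := Nat.cast_ne_zero.2 hb
  have hjα : ∀ x, j (weilSqrt d • x) = -(weilSqrt d • j x) := fun x => by
    rw [hαA, hαA, hjap, hjap, hDA, weilDatumOfKsymm_α_apply, weilDatumOfKsymm_α_apply]
    exact bettiMap_anticomm hφψ x
  have hjj : ∀ x, j (j x) = (b : ℚ) • x := fun x => by
    rw [hjap, hjap]; exact bettiMap_bettiMap_of_comp_eq_nsmul hψ x
  have hjE : ∀ x y, DA.E (j x) y = DA.E x (j y) := fun x y => by
    rw [hjap, hjap, hDA]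
    exact weilDatumOfKsymm_E_map_left_of_anticomm (by omega) hA hev hd hφ hφψ hψ hb e ha ha0 hω hω0 hψh x y
  -- the `K`-module lemma
  have key := Motives.weilDiscriminant_eq_mk_of_typeII DA.E σ hdQ hα hσα hKspan hσ DA.E_swap hWA
    DA.E_nondegenerate j hbQ hjα hjj hjE hVK
  -- the class of the witness is `det H_E`
  obtain ⟨xA, ωA', amA, bmA, qA, hxA, hindA, hωA'r, hωA'0, hpairA, hdetA, hqA⟩ := hδ
  have hdiscA := quotientMk_eq_weilDiscriminant_weilDatumOfKsymm hn hmn hA hd hφ e ha ha0 hω hω0 DA hDA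
    hαA xA ωA' amA bmA qA hxA hindA hωA'r hωA'0 hpairA hdetA
  rw [← hqA]
  exact hdiscA.trans key

/-- **Odd `n` (e.g. SIXFOLDS, `n = 3`): `det H = [-b]`** — the discriminant class of a member carrying `ψ`
with `ψ² = b` determines the quaternion algebra `D = (-d, b)_ℚ = (-d, -δ₀)_ℚ` met on its component.
[cite: vanGeemen1994HodgeAV, Lemma 5.2 (2)–(3) and 4.14] [cite: vanGeemenVerra2003QuaternionicPryms, Lemma 4.5 (proof)] -/
theorem HasWeilDiscriminantNondeg.eq_mk_neg_of_anticomm_of_odd (hn : Odd n) (hmn : m + 1 = 2 * n)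
    (hd : 0 < d) (hA : A.dim = m + 1) (hφ : φ ≫ φ = -(d • 𝟙 A)) (hφψ : φ ≫ ψ = -(ψ ≫ φ))
    (hψ : ψ ≫ ψ = b • 𝟙 A) (hb : b ≠ 0) (e : ProjectiveEmbedding A.X)
    {a : complexBetti (projectiveSpace e.n ℂ) 2} (ha : IsRationalClass a) (ha0 : a ≠ 0)
    (hψh : complexBetti.map ψ.hom.hom.hom 2
        ((d : ℂ) • complexBetti.map e.ι 2 a + complexBetti.map φ.hom.hom.hom 2 (complexBetti.map e.ι 2 a)) =
      (b : ℂ) • ((d : ℂ) • complexBetti.map e.ι 2 a + complexBetti.map φ.hom.hom.hom 2 (complexBetti.map e.ι 2 a)))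
    {δ : weilNormResidueGroup d}
    (hδ : HasWeilDiscriminantNondeg A φ n d
      ((d : ℂ) • complexBetti.map e.ι 2 a + complexBetti.map φ.hom.hom.hom 2 (complexBetti.map e.ι 2 a)) δ) :
    δ = (QuotientGroup.mk (Units.mk0 (-(b : ℚ)) (neg_ne_zero.2 (Nat.cast_ne_zero.2 hb))) :
      weilNormResidueGroup d) := by
  have hn1 : 1 ≤ n := hn.pos
  rw [HasWeilDiscriminantNondeg.eq_mk_neg_pow_of_anticomm hn1 hmn hd hA hφ hφψ hψ hb e ha ha0 hψh hδ]
  obtain ⟨k, rfl⟩ := hn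
  have hdQ : (0 : ℚ) < d := by exact_mod_cast hd
  have hK2 : Module.finrank ℚ (weilField d) = 2 := by
    haveI : Fact (Irreducible (X ^ 2 + C (d : ℚ) : ℚ[X])) := ⟨irreducible_X_sq_add_C hd⟩
    exact Motives.finrank_rat_eq_two_of_sq_eq_neg hdQ (weilSqrt_mul_self_eq_algebraMap d)
      (exists_eq_algebraMap_add_mul_weilSqrt d)
  set u : ℚˣ := Units.mk0 (-(b : ℚ)) (neg_ne_zero.2 (Nat.cast_ne_zero.2 hb)) with hu
  have hunit : Units.mk0 ((-(b : ℚ)) ^ (2 * k + 1)) (pow_ne_zero _ (neg_ne_zero.2 (Nat.cast_ne_zero.2 hb))) =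
      u * (u ^ k) ^ 2 := by
    ext
    simp only [hu, Units.val_mk0, Units.val_mul, Units.val_pow_eq_pow_val]
    ring
  have hmem : (u ^ k) ^ 2 ∈ normUnitsSubgroup ℚ (weilField d) := by
    have h := pow_finrank_mem_normUnitsSubgroup (K := weilField d) (u ^ k)
    rwa [hK2] at h
  rw [hunit, QuotientGroup.mk_mul_of_mem _ hmem]

/-- **Even `n` (fourfolds, eightfolds …): `det H` is trivial** — a member carrying an indefinite-quaternion
`ψ ⊃ K` lies on the SPLIT component `δ = [(-1)ⁿ] = 1` (Deligne–Milne Cor. 4.2).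
[cite: vanGeemen1994HodgeAV, Lemma 5.2 (2)–(3) and 4.14] [cite: Deligne1982HodgeCycles, §4 Cor. 4.2] -/
theorem HasWeilDiscriminantNondeg.eq_one_of_anticomm_of_even (hn : Even n) (hn1 : 1 ≤ n)
    (hmn : m + 1 = 2 * n) (hd : 0 < d) (hA : A.dim = m + 1) (hφ : φ ≫ φ = -(d • 𝟙 A))
    (hφψ : φ ≫ ψ = -(ψ ≫ φ)) (hψ : ψ ≫ ψ = b • 𝟙 A) (hb : b ≠ 0) (e : ProjectiveEmbedding A.X)
    {a : complexBetti (projectiveSpace e.n ℂ) 2} (ha : IsRationalClass a) (ha0 : a ≠ 0)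
    (hψh : complexBetti.map ψ.hom.hom.hom 2
        ((d : ℂ) • complexBetti.map e.ι 2 a + complexBetti.map φ.hom.hom.hom 2 (complexBetti.map e.ι 2 a)) =
      (b : ℂ) • ((d : ℂ) • complexBetti.map e.ι 2 a + complexBetti.map φ.hom.hom.hom 2 (complexBetti.map e.ι 2 a)))
    {δ : weilNormResidueGroup d}
    (hδ : HasWeilDiscriminantNondeg A φ n d
      ((d : ℂ) • complexBetti.map e.ι 2 a + complexBetti.map φ.hom.hom.hom 2 (complexBetti.map e.ι 2 a)) δ) :
    δ = 1 := by
  rw [HasWeilDiscriminantNondeg.eq_mk_neg_pow_of_anticomm hn1 hmn hd hA hφ hφψ hψ hb e ha ha0 hψh hδ]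
  obtain ⟨k, rfl⟩ := hn
  have hdQ : (0 : ℚ) < d := by exact_mod_cast hd
  have hK2 : Module.finrank ℚ (weilField d) = 2 := by
    haveI : Fact (Irreducible (X ^ 2 + C (d : ℚ) : ℚ[X])) := ⟨irreducible_X_sq_add_C hd⟩
    exact Motives.finrank_rat_eq_two_of_sq_eq_neg hdQ (weilSqrt_mul_self_eq_algebraMap d)
      (exists_eq_algebraMap_add_mul_weilSqrt d)
  set u : ℚˣ := Units.mk0 (-(b : ℚ)) (neg_ne_zero.2 (Nat.cast_ne_zero.2 hb)) with hu
  have hunit : Units.mk0 ((-(b : ℚ)) ^ (k + k)) (pow_ne_zero _ (neg_ne_zero.2 (Nat.cast_ne_zero.2 hb))) =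
      (u ^ k) ^ 2 := by
    ext
    simp only [hu, Units.val_mk0, Units.val_pow_eq_pow_val]
    ring
  have hmem : (u ^ k) ^ 2 ∈ normUnitsSubgroup ℚ (weilField d) := by
    have h := pow_finrank_mem_normUnitsSubgroup (K := weilField d) (u ^ k)
    rwa [hK2] at h
  rw [hunit]
  exact (QuotientGroup.eq_one_iff _).2 hmem

end Carriers

end Literature.AlgebraicGeometry.VanGeemen1994

end
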